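import Summits.HodgeConjecture.HodgeConjecture.Theorems.K2E1bDSCellArithmetic          -- ★ (U8 LEVEL-B leaves p856254∕p856269): `tPlus cKPlus tMinus cKMinus` + `bcoef_plus_eq_zero_iff`, `acoef_plus_ne_zero`, mirror, …; re-exports ★ `K2E1bArchPacketSignsDefs` (`IsRegularParam`, `casimirOf`, `centralOf`)
import Literature.RepresentationTheory.Kovacevic2021.SU21PrincipalSeriesSubquotients   -- ★ `subquotient`, `sqSet`, `subquotient_S` (via `SU21SubquotientData`)
import Literature.RepresentationTheory.Kovacevic2021.SU21SubquotientModule            -- ★ `mem_sqSet_bot_iff`, `mem_sqSet_top_iff`, `sqEquivOfBot`, `sqEquiv`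
import HarnessLib

/-!
# K2 ∕ E1b unit U8 «ARCHIMEDEAN PACKET SIGNS», row U8-3 `K2E1bDSCellData`: the Kovačević CELL DATA of the discrete-series packet
# `Π(φ(a,b,c)) = {D_φ, D_φ⁺, D_φ⁻}` of `U(2,1)` as subquotients of the principal series `V(c_K⁺, 2t⁺)`, `V(c_K⁻, 2t⁻)`

HCML Track B «K2-LIT», cell `hodgecm-mathlib`, crux H413 = stmt-HodgeConjecture-24833 (supports-only helper; closes nothing by itself).
DEAL: K2E1b-plan (g2) «DEAL SPEC Q4 = row U8-3» 2026-09-04T00:32:32Z (TABLE `Lines/K2_E1b_GKCohomologyU21_U8_ArchPacketSigns.md` ED. 3 §2 row U8-3,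
LEVEL-B DICTIONARY §2b), hand K2E4-p10 (g2).  DEFINITIONS WITH BODY + proved theorems; no `sorry`, no named `Prop` fact, no instance (one
`attribute [local instance] LieRing.ofAssociativeRing`, the Mathlib idiom every ★ Kovačević file uses), no notation.

## The pattern (★) and what this file does

★ `Literature/RepresentationTheory/Kovacevic2021/SU21HolomorphicCompositionFactors.lean` cuts the CALIBRATION series `V(−3∕2, 6)` (the one through
`φ = ρ`, `(a,b,c) = (1,0,−1)`) by its two `b`-root lines into `holDS | ladderPlus | midDS` (`spanHolRay ⊂ spanHolStrip ⊂ ⊤`).  Here the SAME is done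
at a general parameter `a > b > c` (`IsRegularParam a b c`: `a − b ≥ 2`, `b − c ≥ 2`) for the two series of §2b:
* the `(+)`-series `V(c_K⁺, 2t⁺)`, `t⁺ = 2a − b − c`, `2c_K⁺ = (a−b−1)(a−b+1) − (a−b)(2a−b−c)`: NO `a`-root line on the cone, `b`-root lines EXACTLY at
  `q = a−b−1` and `q = a−c−1`; cells (in cone coordinates `(p,q)`, `K`-type `(n,m) = (1+p+q, 2t+3p−3q)`): `[0,∞)×[0,a−b−1] = D_φ⁺` (`spanDplus`, generated
  by its Blattner corner `(0, a−b−1)`), `[0,∞)×[a−b, a−c−1]` = the `J⁺`-constituent (`spanJplus ∕ spanDplus`), `[0,∞)×[a−c,∞) = D_φ` (`⊤ ∕ spanJplus`);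
* the `(−)`-series `V(c_K⁻, 2t⁻)`, `t⁻ = −a − b + 2c`: no `b`-root line, `a`-root lines exactly at `p = b−c−1` and `p = a−c−1`; cell `[0,b−c−1]×[0,∞) = D_φ⁻`
  (`spanDminus`, generated by its Blattner corner `(b−c−1, 0)`).
`dsCellDatum (j : Fin 3) (a b c : ℤ) : SU21Datum` is the Kovačević datum of the `j`-th member in the ORDER OF ★ `DSPacketCarriers` (`0 ↦ D_φ`, `1 ↦ D_φ⁺`,
`2 ↦ D_φ⁻`), each an honest subquotient datum ★ `SU21Datum.subquotient` of a principal series (so its module IS `N₂ ∕ (N₁ ⊓ N₂)` — ★ `sqEquiv`,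
`sqEquivOfBot`).  PROVED for each cell (all over `IsRegularParam a b c`): the `K`-type set in cone coordinates (`mem_dsCellDatum_S_iff`), STRONG
CONNECTIVITY (`dsCellDatum_reach`, ★ `subquotient_principalSeries_reach`) hence IRREDUCIBILITY (`dsCellDatum_isIrreducible`, ★ `isIrreducible_of_forall_reach`),
the Casimir scalar `κ₀ = casimirOf − centralOf²∕3` on every `K`-type (`dsCellDatum_casimirScalar`, ★ `casimir_principalSeries` `= 4c_K + 2t²∕3` + §1),
INTEGRALITY of the tier-1 twist `6 ∣ m − 3n + 3 + 2e` (`dsCellDatum_integral`), and the BLATTNER VERTICES `D_φ (a−c+1, a+c−2b)`, `D_φ⁺ (a−b, a+b−2c+3)`,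
`D_φ⁻ (b−c, b+c−2a−3)` as `K`-types with their two outward neighbours absent (`dsCellDatum_vertex_*`; for `D_φ` the vertex is a LOCAL MINIMUM and all of
`S` lies in the cone above it).  FILE SPLIT (gate lint: a `Theorems/` file with proofs is ≤ 400 lines): THIS FILE = the DATA — spans, cell data, `dsCellDatum`,
module identifications, and the `K`-type sets in cone coordinates (`mem_dsCellDatum_S_iff`); the LAWS (vertices, strong connectivity ∕ irreducibility, Casimir
scalar and operator, integrality, square-completeness) are `Theorems/K2E1bDSCellDataLaws.lean` (imports this file).  NO model recognition (there is no ★ model at general `(a,b,c)`: the cell datum IS the carrier);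
row U8-4 runs the tier-1 twist ★ `kTypeRepTw` + ★ `isUnitarizable_of_products_nonpos` on these data.

The parameters `tPlus∕cKPlus∕tMinus∕cKMinus` and the ARITHMETIC (root lines `bcoef_plus_eq_zero_iff`∕`acoef_plus_ne_zero`∕mirror, Casimir identities
`casimir_plus∕minus`, `twist_integral_*`, `vertex_*`) are used BY NAME from the ★ LEVEL-B leaves `Theorems/K2E1bDSCellParamsDefs.lean` +
`Theorems/K2E1bDSCellArithmetic.lean` (ns `…U8.LevelB`; the engine line's `Lines/K2_E1b_GKCohomologyU21_U8c_DSCellArithmetic.lean` re-homed VERBATIM on the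
dealer's word 2026-09-04T00:42:43Z, since a `Theorems/` file may not import a `Lines/` module — K2-lead RULING R3 (d)); nothing is re-proved here.

Sources: [Kovacevic2021] D. Kovačević, *Unitary `(𝔤,K)` modules of `SU(2,1)`*, Acta Math. Spalatensia 1 (2021) 105–125 (arXiv:1810.01752), §3 Thm 3
(`V(c,2t)`, (b85)∕(b90) root lines), Remark 3 (Casimir), Remark 6 (subquotients), §4, §6; [BorelWallach2000] A. Borel, N. Wallach, *Continuous cohomology,
discrete subgroups, and representations of reductive groups*, 2nd ed. (2000), VI §4 4.7–4.10 pp. 131–132; [Rogawski1990] §12.3 pp. 176–178 (the packets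
`{D_φ, D_φ⁺, D_φ⁻}`, `JH(i_G(χ_φ^±))`).  HONEST LABEL: HC_CM is proved only modulo the 7 printed citations (2 remaining named inputs: hLiu418 =
stmt-HodgeConjecture-24832, h413 = stmt-HodgeConjecture-24833) until rung 0 closes; U8-3 is a carrier construction and closes nothing by itself.
-/

set_option autoImplicit false
set_option linter.dupNamespace false

noncomputable section

namespace Summit.HodgeConjecture.HodgeConjecture.Cruxes.H413.K2E1bDSCellData

open Literature.RepresentationTheory.Kovacevic2021 Literature.RepresentationTheory.Kovacevic2021.SU21Datum
open Literature.RepresentationTheory.Kovacevic2021.SU21Datum.PrincipalSeries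
open Summit.HodgeConjecture.HodgeConjecture.Cruxes.H413.K2E1bGKCohomologyU21.U8 (IsRegularParam casimirOf centralOf)
open Summit.HodgeConjecture.HodgeConjecture.Cruxes.H413.K2E1bGKCohomologyU21.U8.LevelB

-- Mathlib idiom (Mathlib/Algebra/Lie/OfAssociative.lean): commutator brackets on associative algebras; needed for the `𝔤𝔩(3,ℂ)`-module
-- structure on `𝒟.V` (Lie submodules of `V(c,2t)`), exactly as in every ★ `Kovacevic2021` file and ★ `K2E1bDsDatum`.
attribute [local instance 100] LieRing.ofAssociativeRing

/-! ## §1 The Lie spans of the Blattner corners and their `K`-types (★ `principalSeries_vec_mem_lieSpan_iff`) -/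

/-- `N_{D⁺} = ⟨u^1 at the Blattner corner (p,q) = (0, a−b−1)⟩ ⊆ V(c_K⁺, 2t⁺)`: its `K`-types are the strip `q ≤ a − b − 1` (= `D_φ⁺`).
[cite: Kovacevic2021, §3 proof of Thm 3, Remark 6] [cite: BorelWallach2000, VI §4 4.10] -/
def spanDplus (a b c : ℤ) : LieSubmodule ℂ (Matrix (Fin 3) (Fin 3) ℂ) (principalSeries (cKPlus a b c) (tPlus a b c)).V :=
  LieSubmodule.lieSpan ℂ (Matrix (Fin 3) (Fin 3) ℂ)
    {(principalSeries (cKPlus a b c) (tPlus a b c)).vec (1 + 0 + (a - b - 1)) (2 * tPlus a b c + 3 * 0 - 3 * (a - b - 1)) 1}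

/-- `N_{J⁺} = ⟨u^1 at (p,q) = (0, a−c−1)⟩ ⊆ V(c_K⁺, 2t⁺)`: its `K`-types are the strip `q ≤ a − c − 1` (= `D_φ⁺ + J_φ⁺`).
[cite: Kovacevic2021, §3 proof of Thm 3, Remark 6] [cite: BorelWallach2000, VI §4 4.10] -/
def spanJplus (a b c : ℤ) : LieSubmodule ℂ (Matrix (Fin 3) (Fin 3) ℂ) (principalSeries (cKPlus a b c) (tPlus a b c)).V :=
  LieSubmodule.lieSpan ℂ (Matrix (Fin 3) (Fin 3) ℂ)
    {(principalSeries (cKPlus a b c) (tPlus a b c)).vec (1 + 0 + (a - c - 1)) (2 * tPlus a b c + 3 * 0 - 3 * (a - c - 1)) 1}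

/-- `N_{D⁻} = ⟨u^1 at the Blattner corner (p,q) = (b−c−1, 0)⟩ ⊆ V(c_K⁻, 2t⁻)`: its `K`-types are the strip `p ≤ b − c − 1` (= `D_φ⁻`).
[cite: Kovacevic2021, §3 proof of Thm 3, Remark 6] [cite: BorelWallach2000, VI §4 4.10] -/
def spanDminus (a b c : ℤ) : LieSubmodule ℂ (Matrix (Fin 3) (Fin 3) ℂ) (principalSeries (cKMinus a b c) (tMinus a b c)).V :=
  LieSubmodule.lieSpan ℂ (Matrix (Fin 3) (Fin 3) ℂ)
    {(principalSeries (cKMinus a b c) (tMinus a b c)).vec (1 + (b - c - 1) + 0) (2 * tMinus a b c + 3 * (b - c - 1) - 3 * 0) 1}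

section Regular

variable {a b c : ℤ}

/-- a cone point of `V(c_K⁺, 2t⁺)` is a `K`-type [cite: Kovacevic2021, §3 Thm 3] -/
private theorem memPlus {p q : ℤ} (hp : 0 ≤ p) (hq : 0 ≤ q) :
    ((1 + p + q, 2 * tPlus a b c + 3 * p - 3 * q) : ℤ × ℤ) ∈ (principalSeries (cKPlus a b c) (tPlus a b c)).S :=
  mem_cone hp hq rfl rfl

/-- a cone point of `V(c_K⁻, 2t⁻)` is a `K`-type [cite: Kovacevic2021, §3 Thm 3] -/
private theorem memMinus {p q : ℤ} (hp : 0 ≤ p) (hq : 0 ≤ q) :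
    ((1 + p + q, 2 * tMinus a b c + 3 * p - 3 * q) : ℤ × ℤ) ∈ (principalSeries (cKMinus a b c) (tMinus a b c)).S :=
  mem_cone hp hq rfl rfl

/-- **The `K`-types of `N_{D⁺}`: the strip `q ≤ a−b−1`** (no `a`-root on the cone; the first `b`-root is at `q = a−b−1`).
[cite: Kovacevic2021, §3 proof of Thm 3, Remark 6] -/
theorem vec_mem_spanDplus_iff (h : IsRegularParam a b c) {p q : ℤ} (hp : 0 ≤ p) (hq : 0 ≤ q) :
    (principalSeries (cKPlus a b c) (tPlus a b c)).vec (1 + p + q) (2 * tPlus a b c + 3 * p - 3 * q) 1 ∈ spanDplus a b c ↔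
      q ≤ a - b - 1 := by
  obtain ⟨h1, h2⟩ := h
  rw [spanDplus, principalSeries_vec_mem_lieSpan_iff (cKPlus a b c) (tPlus a b c) (p₀ := 0) (q₀ := a - b - 1) le_rfl (by omega) hp hq]
  constructor
  · rintro ⟨-, hb⟩
    by_contra hlt
    exact hb (a - b - 1) le_rfl (by omega) ((bcoef_plus_eq_zero_iff a b c _).2 (Or.inl rfl))
  · intro hle
    exact ⟨fun r hr _ => acoef_plus_ne_zero (by omega) (by omega) hr, fun s hs hsq => by omega⟩

/-- **The `K`-types of `N_{J⁺}`: the strip `q ≤ a−c−1`** (crossing the first `b`-root line downwards is free; the second is at `q = a−c−1`).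
[cite: Kovacevic2021, §3 proof of Thm 3, Remark 6] -/
theorem vec_mem_spanJplus_iff (h : IsRegularParam a b c) {p q : ℤ} (hp : 0 ≤ p) (hq : 0 ≤ q) :
    (principalSeries (cKPlus a b c) (tPlus a b c)).vec (1 + p + q) (2 * tPlus a b c + 3 * p - 3 * q) 1 ∈ spanJplus a b c ↔
      q ≤ a - c - 1 := by
  obtain ⟨h1, h2⟩ := h
  rw [spanJplus, principalSeries_vec_mem_lieSpan_iff (cKPlus a b c) (tPlus a b c) (p₀ := 0) (q₀ := a - c - 1) le_rfl (by omega) hp hq]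
  constructor
  · rintro ⟨-, hb⟩
    by_contra hlt
    exact hb (a - c - 1) le_rfl (by omega) ((bcoef_plus_eq_zero_iff a b c _).2 (Or.inr rfl))
  · intro hle
    exact ⟨fun r hr _ => acoef_plus_ne_zero (by omega) (by omega) hr, fun s hs hsq => by omega⟩

/-- **The `K`-types of `N_{D⁻}`: the strip `p ≤ b−c−1`** (no `b`-root on the cone; the first `a`-root is at `p = b−c−1`).
[cite: Kovacevic2021, §3 proof of Thm 3, Remark 6] -/
theorem vec_mem_spanDminus_iff (h : IsRegularParam a b c) {p q : ℤ} (hp : 0 ≤ p) (hq : 0 ≤ q) :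
    (principalSeries (cKMinus a b c) (tMinus a b c)).vec (1 + p + q) (2 * tMinus a b c + 3 * p - 3 * q) 1 ∈ spanDminus a b c ↔
      p ≤ b - c - 1 := by
  obtain ⟨h1, h2⟩ := h
  rw [spanDminus, principalSeries_vec_mem_lieSpan_iff (cKMinus a b c) (tMinus a b c) (p₀ := b - c - 1) (q₀ := 0) (by omega) le_rfl hp hq]
  constructor
  · rintro ⟨ha, -⟩
    by_contra hlt
    exact ha (b - c - 1) le_rfl (by omega) ((acoef_minus_eq_zero_iff a b c _).2 (Or.inl rfl))
  · intro hle
    exact ⟨fun r hr hrp => by omega, fun s hs _ => bcoef_minus_ne_zero (by omega) (by omega) hs⟩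

/-! ## §2 The three cell data and `dsCellDatum` -/

end Regular

/-- **`D_φ` as a Kovačević datum**: the top subquotient `V(c_K⁺,2t⁺) ∕ N_{J⁺}` — cone cell `[0,∞)×[a−c,∞)` (quadrant), vertex `(a−c+1, a+c−2b)`.
[cite: BorelWallach2000, VI §4 4.10] [cite: Rogawski1990, §12.3 p. 177] [cite: Kovacevic2021, §3 Remark 6] -/
def dsCellD (a b c : ℤ) : SU21Datum :=
  (principalSeries (cKPlus a b c) (tPlus a b c)).subquotient (spanJplus a b c) ⊤

/-- **`D_φ⁺` as a Kovačević datum**: the sub-datum of `N_{D⁺} ⊆ V(c_K⁺,2t⁺)` — cone cell `[0,∞)×[0,a−b−1]` (strip of height `a−b`), Blattner vertex `(a−b, a+b−2c+3)`.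
[cite: BorelWallach2000, VI §4 4.10] [cite: Rogawski1990, §12.3 p. 177] [cite: Kovacevic2021, §3 Remark 6] -/
def dsCellDplus (a b c : ℤ) : SU21Datum :=
  (principalSeries (cKPlus a b c) (tPlus a b c)).subquotient ⊥ (spanDplus a b c)

/-- **`D_φ⁻` as a Kovačević datum**: the sub-datum of `N_{D⁻} ⊆ V(c_K⁻,2t⁻)` — cone cell `[0,b−c−1]×[0,∞)`, Blattner vertex `(b−c, b+c−2a−3)`.
[cite: BorelWallach2000, VI §4 4.10] [cite: Rogawski1990, §12.3 p. 177] [cite: Kovacevic2021, §3 Remark 6] -/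
def dsCellDminus (a b c : ℤ) : SU21Datum :=
  (principalSeries (cKMinus a b c) (tMinus a b c)).subquotient ⊥ (spanDminus a b c)

/-- **THE CELL DATA OF THE PACKET `Π(φ(a,b,c))`**, indexed as ★ `DSPacketCarriers.cls`: `0 ↦ D_φ`, `1 ↦ D_φ⁺`, `2 ↦ D_φ⁻`.
[cite: Rogawski1990, §12.3 pp. 176–178] [cite: BorelWallach2000, VI §4 4.10] -/
def dsCellDatum (j : Fin 3) (a b c : ℤ) : SU21Datum :=
  ![dsCellD a b c, dsCellDplus a b c, dsCellDminus a b c] j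

/-- `dsCellDatum 0 = D_φ`. [cite: Rogawski1990, §12.3 p. 177] -/
@[simp] theorem dsCellDatum_zero (a b c : ℤ) : dsCellDatum 0 a b c = dsCellD a b c := rfl

/-- `dsCellDatum 1 = D_φ⁺`. [cite: Rogawski1990, §12.3 p. 177] -/
@[simp] theorem dsCellDatum_one (a b c : ℤ) : dsCellDatum 1 a b c = dsCellDplus a b c := rfl

/-- `dsCellDatum 2 = D_φ⁻`. [cite: Rogawski1990, §12.3 p. 177] -/
@[simp] theorem dsCellDatum_two (a b c : ℤ) : dsCellDatum 2 a b c = dsCellDminus a b c := rfl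

/-- The cells as modules: `D_φ⁺`'s datum carries `N_{D⁺}` itself, `D_φ⁻`'s carries `N_{D⁻}`, `D_φ`'s carries `V(c_K⁺,2t⁺) ∕ N_{J⁺}` (`⊤ ∕ ker sqHom`,
★ `SU21SubquotientModule.ker_sqHom`) — as `𝔤𝔩(3,ℂ)`-modules. [cite: Kovacevic2021, §3 Remark 6] -/
theorem dsCellDatum_modules (a b c : ℤ) :
    Nonempty (spanDplus a b c ≃ₗ⁅ℂ, Matrix (Fin 3) (Fin 3) ℂ⁆ (dsCellDatum 1 a b c).V) ∧
      Nonempty (spanDminus a b c ≃ₗ⁅ℂ, Matrix (Fin 3) (Fin 3) ℂ⁆ (dsCellDatum 2 a b c).V) ∧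
      Nonempty (((⊤ : LieSubmodule ℂ (Matrix (Fin 3) (Fin 3) ℂ) (principalSeries (cKPlus a b c) (tPlus a b c)).V) ⧸
          ((principalSeries (cKPlus a b c) (tPlus a b c)).sqHom (spanJplus a b c) ⊤).ker) ≃ₗ⁅ℂ, Matrix (Fin 3) (Fin 3) ℂ⁆
            (dsCellDatum 0 a b c).V) :=
  ⟨⟨sqEquivOfBot (principalSeries (cKPlus a b c) (tPlus a b c)) (spanDplus a b c)⟩,
    ⟨sqEquivOfBot (principalSeries (cKMinus a b c) (tMinus a b c)) (spanDminus a b c)⟩,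
    ⟨sqEquiv (principalSeries (cKPlus a b c) (tPlus a b c)) (spanJplus a b c) ⊤⟩⟩

/-! ## §3 The `K`-types of the cells in cone coordinates -/

section Regular

variable {a b c : ℤ}

/-- `K`-types of `D_φ⁺`'s datum inside the cone of `V(c_K⁺,2t⁺)`: `p ≥ 0`, `0 ≤ q ≤ a−b−1`. [cite: Kovacevic2021, §3 Remark 6] [cite: BorelWallach2000, VI §4 4.10] -/
theorem dsCellDplus_mem_sqSet_iff (h : IsRegularParam a b c) {p q : ℤ} (hp : 0 ≤ p) (hq : 0 ≤ q) :
    ((1 + p + q, 2 * tPlus a b c + 3 * p - 3 * q) : ℤ × ℤ) ∈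
        (principalSeries (cKPlus a b c) (tPlus a b c)).sqSet ⊥ (spanDplus a b c) ↔ p ∈ Set.Ici (0 : ℤ) ∧ q ∈ Set.Icc (0 : ℤ) (a - b - 1) := by
  rw [mem_sqSet_bot_iff, vec_mem_spanDplus_iff h hp hq, Set.mem_Ici, Set.mem_Icc, and_iff_right (memPlus hp hq)]
  omega

/-- `K`-types of `D_φ`'s datum: `p ≥ 0`, `q ≥ a−c`. [cite: Kovacevic2021, §3 Remark 6] [cite: BorelWallach2000, VI §4 4.10] -/
theorem dsCellD_mem_sqSet_iff (h : IsRegularParam a b c) {p q : ℤ} (hp : 0 ≤ p) (hq : 0 ≤ q) :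
    ((1 + p + q, 2 * tPlus a b c + 3 * p - 3 * q) : ℤ × ℤ) ∈
        (principalSeries (cKPlus a b c) (tPlus a b c)).sqSet (spanJplus a b c) ⊤ ↔ p ∈ Set.Ici (0 : ℤ) ∧ q ∈ Set.Ici (a - c) := by
  rw [mem_sqSet_top_iff, vec_mem_spanJplus_iff h hp hq, Set.mem_Ici, Set.mem_Ici, and_iff_right (memPlus hp hq)]
  omega

/-- `K`-types of `D_φ⁻`'s datum inside the cone of `V(c_K⁻,2t⁻)`: `0 ≤ p ≤ b−c−1`, `q ≥ 0`. [cite: Kovacevic2021, §3 Remark 6] [cite: BorelWallach2000, VI §4 4.10] -/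
theorem dsCellDminus_mem_sqSet_iff (h : IsRegularParam a b c) {p q : ℤ} (hp : 0 ≤ p) (hq : 0 ≤ q) :
    ((1 + p + q, 2 * tMinus a b c + 3 * p - 3 * q) : ℤ × ℤ) ∈
        (principalSeries (cKMinus a b c) (tMinus a b c)).sqSet ⊥ (spanDminus a b c) ↔ p ∈ Set.Icc (0 : ℤ) (b - c - 1) ∧ q ∈ Set.Ici (0 : ℤ) := by
  rw [mem_sqSet_bot_iff, vec_mem_spanDminus_iff h hp hq, Set.mem_Ici, Set.mem_Icc, and_iff_right (memMinus hp hq)]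
  omega

/-- **The `K`-types of the three cell data, in cone coordinates** (`j = 0`: `q ≥ a−c`; `j = 1`: `q ≤ a−b−1`; `j = 2`: `p ≤ b−c−1`; series `t⁺, t⁺, t⁻`).
[cite: BorelWallach2000, VI §4 4.10] [cite: Kovacevic2021, §3 Remark 6] -/
theorem mem_dsCellDatum_S_iff (h : IsRegularParam a b c) (n m : ℤ) :
    ((n, m) ∈ (dsCellDatum 0 a b c).S ↔
        ∃ p q : ℤ, 0 ≤ p ∧ 0 ≤ q ∧ n = 1 + p + q ∧ m = 2 * tPlus a b c + 3 * p - 3 * q ∧ a - c ≤ q) ∧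
      ((n, m) ∈ (dsCellDatum 1 a b c).S ↔
        ∃ p q : ℤ, 0 ≤ p ∧ 0 ≤ q ∧ n = 1 + p + q ∧ m = 2 * tPlus a b c + 3 * p - 3 * q ∧ q ≤ a - b - 1) ∧
      ((n, m) ∈ (dsCellDatum 2 a b c).S ↔
        ∃ p q : ℤ, 0 ≤ p ∧ 0 ≤ q ∧ n = 1 + p + q ∧ m = 2 * tMinus a b c + 3 * p - 3 * q ∧ p ≤ b - c - 1) := by
  refine ⟨?_, ?_, ?_⟩
  · rw [dsCellDatum_zero, dsCellD, subquotient_S]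
    constructor
    · intro hx
      obtain ⟨p, q, hp, hq, rfl, rfl⟩ := (mem_principalSeries_S_iff _ _ n m).1 hx.1
      exact ⟨p, q, hp, hq, rfl, rfl, ((dsCellD_mem_sqSet_iff h hp hq).1 hx).2⟩
    · rintro ⟨p, q, hp, hq, rfl, rfl, hc⟩
      exact (dsCellD_mem_sqSet_iff h hp hq).2 ⟨hp, hc⟩
  · rw [dsCellDatum_one, dsCellDplus, subquotient_S]
    constructor
    · intro hx
      obtain ⟨p, q, hp, hq, rfl, rfl⟩ := (mem_principalSeries_S_iff _ _ n m).1 hx.1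
      exact ⟨p, q, hp, hq, rfl, rfl, ((dsCellDplus_mem_sqSet_iff h hp hq).1 hx).2.2⟩
    · rintro ⟨p, q, hp, hq, rfl, rfl, hc⟩
      exact (dsCellDplus_mem_sqSet_iff h hp hq).2 ⟨hp, hq, hc⟩
  · rw [dsCellDatum_two, dsCellDminus, subquotient_S]
    constructor
    · intro hx
      obtain ⟨p, q, hp, hq, rfl, rfl⟩ := (mem_principalSeries_S_iff _ _ n m).1 hx.1
      exact ⟨p, q, hp, hq, rfl, rfl, ((dsCellDminus_mem_sqSet_iff h hp hq).1 hx).1.2⟩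
    · rintro ⟨p, q, hp, hq, rfl, rfl, hc⟩
      exact (dsCellDminus_mem_sqSet_iff h hp hq).2 ⟨⟨hp, hc⟩, hq⟩

end Regular

end Summit.HodgeConjecture.HodgeConjecture.Cruxes.H413.K2E1bDSCellData

end
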